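import Mathlib.Analysis.SpecialFunctions.Sqrt
import Mathlib.Analysis.InnerProductSpace.Calculus
import Mathlib.Analysis.Calculus.Deriv.Basic
import Mathlib.MeasureTheory.Measure.Lebesgue.VolumeOfBalls
import Literature.Analysis.FluidPDE.WholeSpaceIBP
import Literature.MathematicalPhysics.QuantumManyBody.BoseEinsteinCondensation

/-!
# Route BECSubharmonicContinuation · support `HarmonicMinorant` (stmt-AtomisticToContinuum-9003), III:
# the regularised Newton kernels on `ℝ³` and Green's first identity

Helper file (pure analysis on `ℝ³ = Space = EuclideanSpace ℝ (Fin 3)`, the one-particle space of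
`Literature.MathematicalPhysics.QuantumManyBody.BoseGas`). The potential of the uniform unit
charge on the ball `B_a` is `N_a(y) = (3m² - |y|²)/(8πm³)`, `m = max a |y|` — the quadratic
`(3a² - |y|²)/(8πa³)` inside, the Newtonian `1/(4π|y|)` outside, glued `C¹` on the sphere. We prove:

* `hasDerivAt_nprof` — the profile `n_a(q)` in the variable `q = |y|²` (`m = max a √q`) is
  differentiable on all of `ℝ` (one-sided derivatives agree at `q = a²`), whence
  `hasFDerivAt_ubp`: `N_a` is `C¹` on `ℝ³` with `∇N_a(y) = -y/(4πm³)`;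
* the bounds `0 ≤ N_a ≤ 1/(4π|y|)` (`ubp_nonneg`, `ubp_le_newton`: Newton's theorem as an
  inequality) and `N_a ≤ 3/(8πa)` (`ubp_le_center`);
* the **regularised kernel** `T = N_ε - N_S` (`0 < ε ≤ S`) is `C¹` with compact support in `B̄_S`;
* `integral_laplacian_mul_testKernel` — **Green's first identity**
  `∫ Δu·T = -∫ ⟨∇u, ∇T⟩ = ∫ (4π)⁻¹((max ε |y|)⁻³ - (max S |y|)⁻³) Du(y)[y] dy` for `u ∈ C²(ℝ³)`,
  from the tree's boundary-free identity
  `Literature.Analysis.FluidPDE.integral_inner_laplacian_add_eq_zero`.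

Notation in the docstrings: `ℝ³ = Space = EuclideanSpace ℝ (Fin 3)`; `N_a(y) = (3m² - |y|²)/(8πm³)`
with `m = max a |y|` is the potential of the uniform unit charge on `B_a` (written out explicitly in
the statements, no definitions), `n_a(q)` the same profile in the variable `q = |y|²`
(`m = max a √q`), and `K_S(y) = 1/(4π|y|) - (3S² - |y|²)/(8πS³)` the ball kernel.

## References

* D. Gilbarg, N. S. Trudinger, *Elliptic Partial Differential Equations of Second Order*
  (Springer 2001), Thm 2.1 (mean value), (2.10)–(2.17) (Green's identities and representation)
  [GilbargTrudinger2001].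
* E. H. Lieb, R. Seiringer, J. P. Solovej, J. Yngvason, *The Mathematics of the Bose Gas and its
  Condensation* (2005), §1.2 (1.17)–(1.19) (one-body density matrix) [LiebSeiringerSolovejYngvason2005].
-/

noncomputable section

open MeasureTheory Filter Metric Set Function Real InnerProductSpace
open scoped ComplexConjugate Topology RealInnerProductSpace Laplacian

namespace Summit.AtomisticToContinuum.BoseEinsteinCondensation.Theorems

namespace HarmonicMinorant

open Literature.MathematicalPhysics.QuantumManyBody.BoseGas

/-- Inside the ball: `n_a(q) = (3a² - q)/(8πa³)` for `q ≤ a²`. [folklore] -/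
theorem nprof_of_le {a q : ℝ} (ha : 0 < a) (hq : q ≤ a ^ 2) :
    ((3 * (max a (Real.sqrt (q))) ^ 2 - (q)) / (8 * Real.pi * (max a (Real.sqrt (q))) ^ 3)) = (3 * a ^ 2 - q) / (8 * Real.pi * a ^ 3) := by
  have hm : max a (Real.sqrt q) = a := max_eq_left (by
    rw [← Real.sqrt_sq ha.le]; exact Real.sqrt_le_sqrt hq)
  rw [hm]

/-- Outside the ball: `n_a(q) = 1/(4π√q)` for `a² ≤ q`. [folklore] -/
theorem nprof_of_ge {a q : ℝ} (ha : 0 < a) (hq : a ^ 2 ≤ q) :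
    ((3 * (max a (Real.sqrt (q))) ^ 2 - (q)) / (8 * Real.pi * (max a (Real.sqrt (q))) ^ 3)) = (4 * Real.pi * Real.sqrt q)⁻¹ := by
  have hsq : a ≤ Real.sqrt q := by
    rw [← Real.sqrt_sq ha.le]; exact Real.sqrt_le_sqrt hq
  have hspos : 0 < Real.sqrt q := ha.trans_le hsq
  have hm : max a (Real.sqrt q) = Real.sqrt q := max_eq_right hsq
  have hq0 : 0 ≤ q := (sq_nonneg a).trans hq
  rw [hm]
  obtain ⟨s, hs, rfl⟩ : ∃ s : ℝ, 0 < s ∧ s ^ 2 = q :=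
    ⟨Real.sqrt q, hspos, Real.sq_sqrt hq0⟩
  rw [Real.sqrt_sq hs.le]
  field_simp
  ring

/-- The derivative inside: `-1/(8πa³)` for `q ≤ a²`. [folklore] -/
theorem dnprof_of_le {a q : ℝ} (ha : 0 < a) (hq : q ≤ a ^ 2) :
    (-(8 * Real.pi * (max a (Real.sqrt (q))) ^ 3)⁻¹) = -(8 * Real.pi * a ^ 3)⁻¹ := by
  have hm : max a (Real.sqrt q) = a := max_eq_left (by
    rw [← Real.sqrt_sq ha.le]; exact Real.sqrt_le_sqrt hq)
  rw [hm]

/-- The derivative outside: `-1/(8π q √q)` for `a² ≤ q`. [folklore] -/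
theorem dnprof_of_ge {a q : ℝ} (ha : 0 < a) (hq : a ^ 2 ≤ q) :
    (-(8 * Real.pi * (max a (Real.sqrt (q))) ^ 3)⁻¹) = -(8 * Real.pi * (q * Real.sqrt q))⁻¹ := by
  have hsq : a ≤ Real.sqrt q := by
    rw [← Real.sqrt_sq ha.le]; exact Real.sqrt_le_sqrt hq
  have hm : max a (Real.sqrt q) = Real.sqrt q := max_eq_right hsq
  have hq0 : 0 ≤ q := (sq_nonneg a).trans hq
  rw [hm, pow_succ, Real.sq_sqrt hq0]

/-- **The profile is differentiable everywhere** (the two branches glue `C¹` at `q = a²`):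
`HasDerivAt n_a (n_a'(q)) q`. [folklore] -/
theorem hasDerivAt_nprof {a : ℝ} (ha : 0 < a) (q : ℝ) :
    HasDerivAt (fun q : ℝ => ((3 * (max a (Real.sqrt (q))) ^ 2 - (q)) / (8 * Real.pi * (max a (Real.sqrt (q))) ^ 3))) ((-(8 * Real.pi * (max a (Real.sqrt (q))) ^ 3)⁻¹)) q := by
  have ha2 : 0 < a ^ 2 := by positivity
  -- the inner (polynomial) branch
  have hin : ∀ q, HasDerivAt (fun q : ℝ => (3 * a ^ 2 - q) / (8 * Real.pi * a ^ 3))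
      (-(8 * Real.pi * a ^ 3)⁻¹) q := fun q => by
    have h := ((hasDerivAt_id q).const_sub (3 * a ^ 2)).div_const (8 * Real.pi * a ^ 3)
    refine h.congr_deriv ?_
    rw [neg_div, one_div]
  -- the outer (Newtonian) branch
  have hout : ∀ q, 0 < q → HasDerivAt (fun q : ℝ => (4 * Real.pi * Real.sqrt q)⁻¹)
      (-(8 * Real.pi * (q * Real.sqrt q))⁻¹) q := fun q hq => by
    obtain ⟨s, hs, rfl⟩ : ∃ s : ℝ, 0 < s ∧ s ^ 2 = q :=
      ⟨Real.sqrt q, Real.sqrt_pos.2 hq, Real.sq_sqrt hq.le⟩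
    have h1 : HasDerivAt (fun q : ℝ => 4 * Real.pi * Real.sqrt q)
        (4 * Real.pi * (1 / (2 * Real.sqrt (s ^ 2)))) (s ^ 2) :=
      (Real.hasDerivAt_sqrt hq.ne').const_mul _
    have hpos : 4 * Real.pi * Real.sqrt (s ^ 2) ≠ 0 := by positivity
    refine (h1.inv hpos).congr_deriv ?_
    rw [Real.sqrt_sq hs.le]
    field_simp
    ring
  rcases lt_trichotomy q (a ^ 2) with hlt | heq | hgt
  · -- strictly inside: locally the polynomial branch
    have hev : ∀ᶠ p in 𝓝 q, ((3 * (max a (Real.sqrt (p))) ^ 2 - (p)) / (8 * Real.pi * (max a (Real.sqrt (p))) ^ 3)) = (3 * a ^ 2 - p) / (8 * Real.pi * a ^ 3) := by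
      filter_upwards [Iio_mem_nhds hlt] with p hp using nprof_of_le ha hp.le
    rw [dnprof_of_le ha hlt.le]
    exact (hin q).congr_of_eventuallyEq hev
  · -- on the sphere: glue the one-sided derivatives
    subst heq
    have hval : (-(8 * Real.pi * (max a (Real.sqrt (a ^ 2))) ^ 3)⁻¹) = -(8 * Real.pi * a ^ 3)⁻¹ := dnprof_of_le ha le_rfl
    rw [hval]
    have hl : HasDerivWithinAt (fun q : ℝ => ((3 * (max a (Real.sqrt (q))) ^ 2 - (q)) / (8 * Real.pi * (max a (Real.sqrt (q))) ^ 3))) (-(8 * Real.pi * a ^ 3)⁻¹) (Iic (a ^ 2))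
        (a ^ 2) :=
      (hin (a ^ 2)).hasDerivWithinAt.congr (fun p hp => nprof_of_le ha hp) (nprof_of_le ha le_rfl)
    have hr : HasDerivWithinAt (fun q : ℝ => ((3 * (max a (Real.sqrt (q))) ^ 2 - (q)) / (8 * Real.pi * (max a (Real.sqrt (q))) ^ 3))) (-(8 * Real.pi * a ^ 3)⁻¹) (Ici (a ^ 2))
        (a ^ 2) := by
      have h1 := (hout (a ^ 2) ha2).hasDerivWithinAt (s := Ici (a ^ 2))
      have h2 : -(8 * Real.pi * (a ^ 2 * Real.sqrt (a ^ 2)))⁻¹ = -(8 * Real.pi * a ^ 3)⁻¹ := by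
        rw [Real.sqrt_sq ha.le]; ring
      rw [h2] at h1
      exact h1.congr (fun p hp => nprof_of_ge ha hp) (nprof_of_ge ha le_rfl)
    have h := hl.union hr
    rwa [Iic_union_Ici, hasDerivWithinAt_univ] at h
  · -- strictly outside: locally the Newtonian branch
    have hq : 0 < q := ha2.trans hgt
    have hev : ∀ᶠ p in 𝓝 q, ((3 * (max a (Real.sqrt (p))) ^ 2 - (p)) / (8 * Real.pi * (max a (Real.sqrt (p))) ^ 3)) = (4 * Real.pi * Real.sqrt p)⁻¹ := by
      filter_upwards [Ioi_mem_nhds hgt] with p hp using nprof_of_ge ha hp.le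
    rw [dnprof_of_ge ha hgt.le]
    exact (hout q hq).congr_of_eventuallyEq hev

/-! ### The uniform-ball potentials on `Space` -/



/-- The profile at `q = |y|²` is the uniform-ball potential `N_a(y)`. [folklore] -/
theorem nprof_norm_sq (a : ℝ) (y : Space) : ((3 * (max a (Real.sqrt (‖y‖ ^ 2))) ^ 2 - (‖y‖ ^ 2)) / (8 * Real.pi * (max a (Real.sqrt (‖y‖ ^ 2))) ^ 3)) = ((3 * (max a ‖y‖) ^ 2 - ‖y‖ ^ 2) / (8 * Real.pi * (max a ‖y‖) ^ 3)) := by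
  rw [Real.sqrt_sq (norm_nonneg _)]

/-- The profile derivative at `q = |y|²` is the radial factor `-1/(8π m³)`, `m = max a |y|`. [folklore] -/
theorem dnprof_norm_sq (a : ℝ) (y : Space) : (-(8 * Real.pi * (max a (Real.sqrt (‖y‖ ^ 2))) ^ 3)⁻¹) = (-(8 * Real.pi * (max a ‖y‖) ^ 3)⁻¹) := by
  rw [Real.sqrt_sq (norm_nonneg _)]

/-- **`N_a` is differentiable everywhere**, `DN_a(y) = (-(8 * Real.pi * (max a ‖y‖) ^ 3)⁻¹) · 2⟨y, ·⟩`. [folklore] -/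
theorem hasFDerivAt_ubp {a : ℝ} (ha : 0 < a) (y : Space) :
    HasFDerivAt (fun y : Space => ((3 * (max a ‖y‖) ^ 2 - ‖y‖ ^ 2) / (8 * Real.pi * (max a ‖y‖) ^ 3)))
      (((-(8 * Real.pi * (max a ‖y‖) ^ 3)⁻¹)) • ((2 : ℕ) • (innerSL ℝ y : Space →L[ℝ] ℝ))) y := by
  have h0 : HasFDerivAt (fun y : Space => ‖y‖ ^ 2) ((2 : ℕ) • (innerSL ℝ y : Space →L[ℝ] ℝ)) y :=
    (hasStrictFDerivAt_norm_sq y).hasFDerivAt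
  have h1 := (hasDerivAt_nprof ha (‖y‖ ^ 2)).comp_hasFDerivAt y h0
  rw [dnprof_norm_sq] at h1
  refine h1.congr_of_eventuallyEq (Eventually.of_forall fun z => ?_)
  simp only [Function.comp_apply]
  exact (nprof_norm_sq a z).symm

/-- Inside the ball `N_a` is the quadratic `(3a² - |y|²)/(8πa³)`. [folklore] -/
theorem ubp_of_norm_le {a : ℝ} {y : Space} (hy : ‖y‖ ≤ a) :
    ((3 * (max a ‖y‖) ^ 2 - ‖y‖ ^ 2) / (8 * Real.pi * (max a ‖y‖) ^ 3)) = (3 * a ^ 2 - ‖y‖ ^ 2) / (8 * Real.pi * a ^ 3) := by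
  rw [max_eq_left hy]

/-- Outside the ball `N_a` is the Newtonian potential `1/(4π|y|)`. [folklore] -/
theorem ubp_of_le_norm {a : ℝ} (ha : 0 < a) {y : Space} (hy : a ≤ ‖y‖) :
    ((3 * (max a ‖y‖) ^ 2 - ‖y‖ ^ 2) / (8 * Real.pi * (max a ‖y‖) ^ 3)) = (4 * Real.pi * ‖y‖)⁻¹ := by
  rw [max_eq_right hy]
  have hy0 : 0 < ‖y‖ := ha.trans_le hy
  field_simp
  ring

/-- `N_a ≥ 0`. [folklore] -/
theorem ubp_nonneg {a : ℝ} (ha : 0 < a) (y : Space) : 0 ≤ ((3 * (max a ‖y‖) ^ 2 - ‖y‖ ^ 2) / (8 * Real.pi * (max a ‖y‖) ^ 3)) := by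
  have hm : 0 < max a ‖y‖ := lt_max_of_lt_left ha
  refine div_nonneg ?_ (by positivity)
  nlinarith [le_max_right a ‖y‖, norm_nonneg y, sq_nonneg (max a ‖y‖ - ‖y‖)]

/-- `N_a ≤ 3/(8πa)` (its value at the centre). [folklore] -/
theorem ubp_le_center {a : ℝ} (ha : 0 < a) (y : Space) : ((3 * (max a ‖y‖) ^ 2 - ‖y‖ ^ 2) / (8 * Real.pi * (max a ‖y‖) ^ 3)) ≤ 3 / (8 * Real.pi * a) := by
  have hm : a ≤ max a ‖y‖ := le_max_left _ _
  have hm0 : 0 < max a ‖y‖ := lt_max_of_lt_left ha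
  rw [div_le_div_iff₀ (by positivity) (by positivity)]
  have h1 : (3 * max a ‖y‖ ^ 2 - ‖y‖ ^ 2) ≤ 3 * max a ‖y‖ ^ 2 := by nlinarith [sq_nonneg ‖y‖]
  calc (3 * max a ‖y‖ ^ 2 - ‖y‖ ^ 2) * (8 * Real.pi * a)
      ≤ 3 * max a ‖y‖ ^ 2 * (8 * Real.pi * a) := by
        exact mul_le_mul_of_nonneg_right h1 (by positivity)
    _ ≤ 3 * (8 * Real.pi * max a ‖y‖ ^ 3) := by
        have : max a ‖y‖ ^ 2 * a ≤ max a ‖y‖ ^ 3 := by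
          rw [pow_succ]
          exact mul_le_mul_of_nonneg_left hm (by positivity)
        nlinarith [Real.pi_pos]

/-- **Newton's bound** `N_a(y) ≤ 1/(4π|y|)`: the potential of the spread-out unit charge is below
that of the point charge. [folklore] -/
theorem ubp_le_newton {a : ℝ} (ha : 0 < a) {y : Space} (hy : y ≠ 0) :
    ((3 * (max a ‖y‖) ^ 2 - ‖y‖ ^ 2) / (8 * Real.pi * (max a ‖y‖) ^ 3)) ≤ (4 * Real.pi * ‖y‖)⁻¹ := by
  rcases le_total a ‖y‖ with h | h
  · rw [ubp_of_le_norm ha h]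
  · rw [ubp_of_norm_le h]
    have hy0 : 0 < ‖y‖ := norm_pos_iff.2 hy
    rw [div_le_iff₀ (by positivity), ← sub_nonneg]
    have key : (4 * Real.pi * ‖y‖)⁻¹ * (8 * Real.pi * a ^ 3) - (3 * a ^ 2 - ‖y‖ ^ 2) =
        (2 * a ^ 3 - 3 * a ^ 2 * ‖y‖ + ‖y‖ ^ 3) / ‖y‖ := by
      field_simp
      ring
    rw [key]
    refine div_nonneg ?_ hy0.le
    nlinarith [mul_nonneg (mul_nonneg (sub_nonneg.2 h) (sub_nonneg.2 h))
      (show (0 : ℝ) ≤ 2 * a + ‖y‖ by positivity)]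

/-! ### The regularised kernel `T = N_ε - N_S` as a test function -/

/-- Continuity of the radial derivative factor. [folklore] -/
theorem continuous_dubp {a : ℝ} (ha : 0 < a) : Continuous fun y : Space => (-(8 * Real.pi * (max a ‖y‖) ^ 3)⁻¹) := by
  refine Continuous.neg (Continuous.inv₀ (by fun_prop) fun y => ?_)
  have : 0 < max a ‖y‖ := lt_max_of_lt_left ha
  positivity

/-- **The regularised kernel is `C¹`** with derivative `(dubp ε - dubp S)(y) · 2⟨y,·⟩`. [folklore] -/
theorem hasFDerivAt_testKernel {ε S : ℝ} (hε : 0 < ε) (hS : 0 < S) (y : Space) :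
    HasFDerivAt (fun y : Space => ((3 * (max ε ‖y‖) ^ 2 - ‖y‖ ^ 2) / (8 * Real.pi * (max ε ‖y‖) ^ 3)) - ((3 * (max S ‖y‖) ^ 2 - ‖y‖ ^ 2) / (8 * Real.pi * (max S ‖y‖) ^ 3)))
      (((-(8 * Real.pi * (max ε ‖y‖) ^ 3)⁻¹) - (-(8 * Real.pi * (max S ‖y‖) ^ 3)⁻¹)) • ((2 : ℕ) • (innerSL ℝ y : Space →L[ℝ] ℝ))) y := by
  have h := (hasFDerivAt_ubp hε y).sub (hasFDerivAt_ubp hS y)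
  rw [← sub_smul] at h
  exact h

/-- The regularised kernel `N_ε - N_S` is `C¹`. [folklore] -/
theorem contDiff_testKernel {ε S : ℝ} (hε : 0 < ε) (hS : 0 < S) :
    ContDiff ℝ 1 (fun y : Space => ((3 * (max ε ‖y‖) ^ 2 - ‖y‖ ^ 2) / (8 * Real.pi * (max ε ‖y‖) ^ 3)) - ((3 * (max S ‖y‖) ^ 2 - ‖y‖ ^ 2) / (8 * Real.pi * (max S ‖y‖) ^ 3))) := by
  refine contDiff_one_iff_hasFDerivAt.2 ⟨_, ?_, fun y => hasFDerivAt_testKernel hε hS y⟩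
  exact ((continuous_dubp hε).sub (continuous_dubp hS)).smul
    ((innerSL ℝ (E := Space)).continuous.const_smul (2 : ℕ))

/-- The regularised kernel vanishes off the ball of radius `S` (for `ε ≤ S`). [folklore] -/
theorem testKernel_eq_zero {ε S : ℝ} (hε : 0 < ε) (hεS : ε ≤ S) {y : Space} (hy : S ≤ ‖y‖) :
    ((3 * (max ε ‖y‖) ^ 2 - ‖y‖ ^ 2) / (8 * Real.pi * (max ε ‖y‖) ^ 3)) - ((3 * (max S ‖y‖) ^ 2 - ‖y‖ ^ 2) / (8 * Real.pi * (max S ‖y‖) ^ 3)) = 0 := by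
  rw [ubp_of_le_norm hε (hεS.trans hy), ubp_of_le_norm (hε.trans_le hεS) hy, sub_self]

/-- The regularised kernel `N_ε - N_S` has compact support (in `B̄_S`). [folklore] -/
theorem hasCompactSupport_testKernel {ε S : ℝ} (hε : 0 < ε) (hεS : ε ≤ S) :
    HasCompactSupport (fun y : Space => ((3 * (max ε ‖y‖) ^ 2 - ‖y‖ ^ 2) / (8 * Real.pi * (max ε ‖y‖) ^ 3)) - ((3 * (max S ‖y‖) ^ 2 - ‖y‖ ^ 2) / (8 * Real.pi * (max S ‖y‖) ^ 3))) := by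
  refine HasCompactSupport.intro (isCompact_closedBall (0 : Space) S) fun y hy => ?_
  rw [mem_closedBall_zero_iff, not_le] at hy
  exact testKernel_eq_zero hε hεS hy.le

/-! ### Green's first identity against the regularised kernel -/

/-- **Green's first identity against the regularised kernel**: for `u ∈ C²(Space)`,
`∫ Δu · T = -∫ 2(dubp ε - dubp S)(y) · Du(y)[y] dy` (no boundary terms: `T` is `C¹` with compact
support; `Σᵢ ∂ᵢu ∂ᵢT = ⟨∇u, ∇T⟩` and `∇T(y) = 2(dubp ε - dubp S)(y) y`).
[cite: GilbargTrudinger2001, (2.10)] -/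
theorem integral_laplacian_mul_testKernel {ε S : ℝ} (hε : 0 < ε) (hεS : ε ≤ S) {u : Space → ℝ}
    (hu : ContDiff ℝ 2 u) :
    ∫ y, (Δ u) y * (((3 * (max ε ‖y‖) ^ 2 - ‖y‖ ^ 2) / (8 * Real.pi * (max ε ‖y‖) ^ 3)) - ((3 * (max S ‖y‖) ^ 2 - ‖y‖ ^ 2) / (8 * Real.pi * (max S ‖y‖) ^ 3))) =
      -∫ y, (2 * ((-(8 * Real.pi * (max ε ‖y‖) ^ 3)⁻¹) - (-(8 * Real.pi * (max S ‖y‖) ^ 3)⁻¹))) * fderiv ℝ u y y := by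
  have hS : 0 < S := hε.trans_le hεS
  set b := EuclideanSpace.basisFun (Fin 3) ℝ
  set T : Space → ℝ := fun y => ((3 * (max ε ‖y‖) ^ 2 - ‖y‖ ^ 2) / (8 * Real.pi * (max ε ‖y‖) ^ 3)) - ((3 * (max S ‖y‖) ^ 2 - ‖y‖ ^ 2) / (8 * Real.pi * (max S ‖y‖) ^ 3)) with hT
  have hT1 : ContDiff ℝ 1 T := contDiff_testKernel hε hS
  have hTc : HasCompactSupport T := hasCompactSupport_testKernel hε hεS
  have green := Literature.Analysis.FluidPDE.integral_inner_laplacian_add_eq_zero b hu hT1 (Or.inr hTc)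
  have hfd : ∀ y, fderiv ℝ T y = ((-(8 * Real.pi * (max ε ‖y‖) ^ 3)⁻¹) - (-(8 * Real.pi * (max S ‖y‖) ^ 3)⁻¹)) • ((2 : ℕ) • (innerSL ℝ y : Space →L[ℝ] ℝ)) :=
    fun y => (hasFDerivAt_testKernel hε hS y).fderiv
  have key : ∀ y, (2 * ((-(8 * Real.pi * (max ε ‖y‖) ^ 3)⁻¹) - (-(8 * Real.pi * (max S ‖y‖) ^ 3)⁻¹))) * fderiv ℝ u y y =
      ∑ i, ⟪fderiv ℝ u y (b i), fderiv ℝ T y (b i)⟫ := fun y => by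
    have hs : fderiv ℝ u y y = ∑ i, ⟪b i, y⟫ * fderiv ℝ u y (b i) := by
      have : fderiv ℝ u y y = fderiv ℝ u y (∑ i, ⟪b i, y⟫ • b i) := by rw [b.sum_repr' y]
      rw [this, map_sum]
      simp only [map_smul, smul_eq_mul]
    rw [hs, Finset.mul_sum]
    refine Finset.sum_congr rfl fun i _ => ?_
    rw [hfd y]
    simp only [FunLike.coe_smul, Pi.smul_apply]
    simp only [smul_eq_mul, nsmul_eq_mul, Nat.cast_ofNat, innerSL_apply_apply]
    simp only [RCLike.inner_apply, conj_trivial]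
    rw [real_inner_comm]
    ring
  have hint : ∀ i, Integrable (fun y => ⟪fderiv ℝ u y (b i), fderiv ℝ T y (b i)⟫)
      (volume : Measure Space) := fun i => by
    refine Continuous.integrable_of_hasCompactSupport ?_ ?_
    · exact (((hu.continuous_fderiv (by norm_num)).clm_apply continuous_const)).inner
        ((hT1.continuous_fderiv one_ne_zero).clm_apply continuous_const)
    · exact (hTc.fderiv_apply (𝕜 := ℝ) (b i)).mono fun y hy => by
        contrapose! hy
        simp only [mem_support, not_not] at hy
        simp [hy]
  have h0 : ∫ y, ⟪(Δ u) y, T y⟫ = ∫ y, (Δ u) y * T y := by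
    refine integral_congr_ae (Eventually.of_forall fun y => ?_)
    simp only [RCLike.inner_apply, conj_trivial]
    ring
  rw [h0] at green
  simp_rw [key]
  rw [integral_finsetSum _ fun i _ => hint i]
  linarith

end HarmonicMinorant

end Summit.AtomisticToContinuum.BoseEinsteinCondensation.Theorems
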